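import Summits.FinalStateConjecture.FinalStateConjecture.Theorems.BartnikGapSettlingGapExhaustionMultiplierOfTimelike
import Literature.Geometry.Lorentzian.CoordLaplacianPerturbation
import Literature.Geometry.Lorentzian.KerrSchild
import HarnessLib

/-!
# `FarPointMultiplier`: the `T`-conditional multiplier at a far cylinder point
(crux `GapExhaustion`, stmt-FinalStateConjecture-10808, line photon-shell-pseudoconvexity;
registered stub `stub_farPointMultiplier`, far chain F2b of the conditional Killing sweep,
lead c12 wave 4)

Far out on an eternal near-Kerr chart the stationary direction `∂₀` is uniformly timelike and
the metric components `G x` are close to Minkowski's `η`, so Ionescu–Klainerman's quantitative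
`T`-null-convexity condition (Surveys in Differential Geometry **20** (2015), Lemma 2.17;
Invent. Math. **175** (2009), Definition 3.1 (po3))

  `ε₁² |Y|² ≤ μ g(Y, Y) − c · Hess r (Y, Y) + ε₁⁻² (|g(∂₀, Y)|² + |Y(r)|²)`   for all `Y`

holds at a far cylinder point `x` (`r(x) = c`) for ANY bounded Hessian term: this file packages
the pure algebra of `stub_multiplierOfTimelike` (far chain F2a) in the point form consumed by the
far local step, the Hessian being scaled by the extra factor `c` of the normalisation `f = r`.

Proof: the coordinate Hessian endomorphism bound `MetricCoord.norm_hessAt_apply_le`,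
`‖Hess r (X, ·)‖ ≤ (‖D²r‖ + ‖Dr‖ (3/2) ‖♯‖ ‖DG‖) ‖X‖`, with `‖D²r(x)‖ ≤ C_K / c`,
`‖Dr(x)‖ ≤ C_K`, `‖DG(x)‖ ≤ θ / c ≤ 1 / c` and `‖♯_{G(x)}‖ ≤ 2` (from `‖G x − η‖ ≤ 1/2` and the
coercivity `‖v‖ ≤ ‖η(v, ·)‖` of `η`), gives `‖c • Hess r‖ ≤ C_K + 3 C_K = 4 C_K =: C`; then F2a
with `S = G x`, `H = c • Hess r`, `v = ∂₀`, `D = Dr(x)` yields the claim with `μ = C + 2`,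
`ε₁ = 1/(4(C+2))`, `θ = 1/(20(C+2))`, all depending on `C_K` only.

## References

* A. D. Ionescu, S. Klainerman, *Rigidity results in general relativity: a review*, Surveys in
  Differential Geometry 20 (2015), Lemma 2.17. [IonescuKlainerman2015]
* A. D. Ionescu, S. Klainerman, *On the uniqueness of smooth, stationary black holes in vacuum*,
  Invent. Math. 175 (2009), Definition 3.1.
* B. O'Neill, *Semi-Riemannian geometry*, Academic Press 1983, Ch. 3, p. 55, Lemma 3.49.
  [ONeill1983]
-/

noncomputable section

-- instance search through the nested operator types `E4 →L[ℝ] E4 →L[ℝ] ℝ`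
set_option maxSynthPendingDepth 3

-- D-0017: single-problem summit, `Summit.<S>.<S>.…` by design (cf. lakefile `weak.linter.dupNamespace`).
set_option linter.dupNamespace false

namespace Summit.FinalStateConjecture.FinalStateConjecture.Theorems

open Set Function Metric
open Literature.Geometry.Lorentzian Literature.Geometry.Lorentzian.MetricCoord
open scoped Manifold ContDiff Topology ENNReal

/-- **Coercivity of `η`**: `‖v‖ ≤ ‖η(v, ·)‖` on `E4 = ℝ⁴` with the Euclidean norm (test against
the time-reflected vector `v − 2 v⁰ ∂₀`, on which `η(v, ·)` takes the value `‖v‖²`;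
O'Neill 1983, Ch. 3, p. 55). [folklore] -/
private theorem farMult_norm_le_norm_minkowski_apply (v : E4) : ‖v‖ ≤ ‖Minkowski.bilin v‖ := by
  -- the time reflection `w` of `v`
  set w : E4 := v - (2 * v 0) • E4.basisVector 0 with hw
  have hw0 : w 0 = -v 0 := by
    simp [hw, E4.basisVector]
    ring
  have hwi : ∀ i : Fin 3, w i.succ = v i.succ := fun i ↦ by
    simp [hw, E4.basisVector, Fin.succ_ne_zero]
  have hnorm : ‖w‖ = ‖v‖ := by
    have h2 : ‖w‖ ^ 2 = ‖v‖ ^ 2 := by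
      simp only [EuclideanSpace.real_norm_sq_eq, Fin.sum_univ_succ, Fin.sum_univ_zero, hw0, hwi]
      ring
    exact (sq_eq_sq₀ (norm_nonneg _) (norm_nonneg _)).1 h2
  have happ : Minkowski.bilin v w = ‖v‖ ^ 2 := by
    simp only [Minkowski.bilin_apply, hw0, hwi, EuclideanSpace.real_norm_sq_eq, Fin.sum_univ_succ,
      Fin.sum_univ_zero]
    ring
  have hle : ‖v‖ ^ 2 ≤ ‖Minkowski.bilin v‖ * ‖v‖ := by
    calc ‖v‖ ^ 2 = Minkowski.bilin v w := happ.symm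
      _ ≤ ‖Minkowski.bilin v w‖ := Real.le_norm_self _
      _ ≤ ‖Minkowski.bilin v‖ * ‖w‖ := (Minkowski.bilin v).le_opNorm w
      _ = ‖Minkowski.bilin v‖ * ‖v‖ := by rw [hnorm]
  by_cases hv : v = 0
  · rw [hv, norm_zero]
    exact norm_nonneg _
  · have hvpos : 0 < ‖v‖ := norm_pos_iff.2 hv
    rw [pow_two] at hle
    exact le_of_mul_le_mul_right hle hvpos

/-- **`‖♯‖ ≤ 2` near Minkowski**: if `G x` is invertible and `‖G x − η‖ ≤ 1/2`, then
`‖G x v‖ ≥ ‖η v‖ − ‖v‖/2 ≥ ‖v‖/2`, so the index-raising map has `‖♯_{G(x)}‖ ≤ 2`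
(the flat sharp is an isometry; O'Neill 1983, Ch. 3, p. 60). [folklore] -/
private theorem farMult_norm_sharpAt_le_two {G : E4 → E4 →L[ℝ] E4 →L[ℝ] ℝ} {x : E4}
    (hinv : (G x).IsInvertible) (hclose : ‖G x - Minkowski.bilin‖ ≤ 1 / 2) :
    ‖sharpAt G x‖ ≤ 2 := by
  have hcoer : ∀ v : E4, ‖v‖ ≤ 2 * ‖G x v‖ := fun v ↦ by
    have h1 := farMult_norm_le_norm_minkowski_apply v
    have h2 : ‖Minkowski.bilin v - G x v‖ ≤ 1 / 2 * ‖v‖ := by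
      rw [← sub_apply]
      calc ‖(Minkowski.bilin - G x) v‖ ≤ ‖Minkowski.bilin - G x‖ * ‖v‖ :=
            (Minkowski.bilin - G x).le_opNorm v
        _ ≤ 1 / 2 * ‖v‖ := by
            rw [norm_sub_rev]
            exact mul_le_mul_of_nonneg_right hclose (norm_nonneg v)
    have h3 := norm_sub_norm_le (Minkowski.bilin v) (G x v)
    linarith
  refine ContinuousLinearMap.opNorm_le_bound _ zero_le_two fun α ↦ ?_
  have h := hcoer (sharpAt G x α)
  rw [apply_sharpAt hinv] at h
  exact h

/-- `‖D(Df)(x)‖ = ‖D²f(x)‖`: the operator norm of the curried second derivative is the norm of the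
second iterated Fréchet derivative (currying is an isometry). [folklore] -/
private theorem farMult_norm_fderiv_fderiv (f : E4 → ℝ) (x : E4) :
    ‖fderiv ℝ (fderiv ℝ f) x‖ = ‖iteratedFDeriv ℝ 2 f x‖ := by
  rw [← norm_iteratedFDeriv_one, norm_iteratedFDeriv_fderiv]

/-- `(c • B)(w, w) = c · B(w, w)`. [folklore] -/
private theorem farMult_smul_apply₂ (c : ℝ) (B : E4 →L[ℝ] E4 →L[ℝ] ℝ) (w : E4) :
    (c • B) w w = c * B w w := by
  simp only [smul_apply, smul_eq_mul]

/-- **The `T`-conditional multiplier at a far cylinder point** (registered stub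
`stub_farPointMultiplier`, far chain F2b of line photon-shell-pseudoconvexity, crux
`GapExhaustion`): for every bound `C_K ≥ 0` there are `θ ∈ (0, 1]` and `ε₁ > 0` (depending on
`C_K` only) such that at every point `x` of a metric chart `(G, W)` with `r(x) = c > 0`,
`‖Dr(x)‖ ≤ C_K`, `‖D²r(x)‖ ≤ C_K / c`, `‖G x − η‖ ≤ θ` and `‖DG(x)‖ ≤ θ / c`
(`r = Kerr.radius a`), Ionescu–Klainerman's multiplier inequality (Surveys Diff. Geom. 20 (2015),
Lemma 2.17; Invent. Math. 175 (2009), Definition 3.1 (po3)) holds with conditioning vector `∂₀`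
and the Hessian term scaled by `c`:
`ε₁²‖w‖² ≤ μ G_x(w,w) − c Hess r (w,w) + ε₁⁻² (G_x(∂₀,w)² + (Dr(x) w)²)` for some `|μ| ≤ ε₁⁻¹`.
From F2a (`stub_multiplierOfTimelike`) with `H = c • Hess r`, `‖H‖ ≤ 4 C_K` by
`MetricCoord.norm_hessAt_apply_le` and `‖♯‖ ≤ 2`. [cite: IonescuKlainerman2015, Lemma 2.17] -/
theorem stub_farPointMultiplier : ∀ (CK : ℝ), 0 ≤ CK → ∃ (θ ε₁ : ℝ), 0 < θ ∧ θ ≤ 1 ∧ 0 < ε₁ ∧ ∀ (G : E4 → E4 →L[ℝ] E4 →L[ℝ] ℝ) (W : Set E4) (a c : ℝ) (x : E4), IsMetricOn G W → x ∈ W → Kerr.radius a x = c → 0 < c → ‖fderiv ℝ (Kerr.radius a) x‖ ≤ CK → ‖iteratedFDeriv ℝ 2 (Kerr.radius a) x‖ ≤ CK / c → ‖G x - Minkowski.bilin‖ ≤ θ → ‖fderiv ℝ G x‖ ≤ θ / c → ∃ μ : ℝ, |μ| ≤ ε₁⁻¹ ∧ ∀ w : E4, ε₁ ^ 2 * ‖w‖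 ^ 2 ≤ μ * G x w w - c * hessAt G (Kerr.radius a) x w w + ε₁⁻¹ ^ 2 * ((G x (E4.basisVector 0) w) ^ 2 + (fderiv ℝ (Kerr.radius a) x w) ^ 2) := by
  intro CK hCK
  -- the Hessian bound `C = 4 C_K` and IK's constants `θ = 1/(20(C+2))`, `ε₁ = 1/(4(C+2))`
  obtain ⟨C, hC_eq⟩ : ∃ C : ℝ, C = 4 * CK := ⟨_, rfl⟩
  have hC : 0 ≤ C := by rw [hC_eq]; positivity
  have hK : 0 < C + 2 := by linarith
  have hθhalf : 1 / (20 * (C + 2)) ≤ 1 / 2 :=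
    one_div_le_one_div_of_le (by norm_num) (by linarith)
  refine ⟨1 / (20 * (C + 2)), 1 / (4 * (C + 2)), by positivity, hθhalf.trans (by norm_num),
    by positivity, ?_⟩
  intro G W a c x hG hx _hrc hc hDr hD2r hGη hDG
  -- (1) `‖♯_{G(x)}‖ ≤ 2`
  have hsharp : ‖sharpAt G x‖ ≤ 2 :=
    farMult_norm_sharpAt_le_two (hG.isInvertible x hx) (hGη.trans hθhalf)
  -- (2) the scaled coordinate Hessian `H = c • Hess r` has `‖H‖ ≤ C`
  have hB0 : 0 ≤ ‖fderiv ℝ (fderiv ℝ (Kerr.radius a)) x‖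
      + ‖fderiv ℝ (Kerr.radius a) x‖ * (2⁻¹ * (‖sharpAt G x‖ * (3 * ‖fderiv ℝ G x‖))) := by
    positivity
  have hHess : ‖hessAt G (Kerr.radius a) x‖ ≤ ‖fderiv ℝ (fderiv ℝ (Kerr.radius a)) x‖
      + ‖fderiv ℝ (Kerr.radius a) x‖ * (2⁻¹ * (‖sharpAt G x‖ * (3 * ‖fderiv ℝ G x‖))) :=
    ContinuousLinearMap.opNorm_le_bound _ hB0 fun X ↦
      norm_hessAt_apply_le (G := G) (y := x) (Kerr.radius a) X
  have h1 : c * ‖fderiv ℝ (fderiv ℝ (Kerr.radius a)) x‖ ≤ CK := by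
    rw [farMult_norm_fderiv_fderiv, mul_comm]
    exact (le_div_iff₀ hc).1 hD2r
  have h2 : c * ‖fderiv ℝ G x‖ ≤ 1 := by
    rw [mul_comm]
    exact ((le_div_iff₀ hc).1 hDG).trans (hθhalf.trans (by norm_num))
  have h3 : ‖sharpAt G x‖ * (c * ‖fderiv ℝ G x‖) ≤ 2 * 1 :=
    mul_le_mul hsharp h2 (by positivity) zero_le_two
  have h4 : ‖fderiv ℝ (Kerr.radius a) x‖ * (‖sharpAt G x‖ * (c * ‖fderiv ℝ G x‖)) ≤ CK * (2 * 1) :=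
    mul_le_mul hDr h3 (by positivity) hCK
  have hHn : ‖c • hessAt G (Kerr.radius a) x‖ ≤ C := by
    rw [norm_smul, Real.norm_eq_abs, abs_of_pos hc]
    calc c * ‖hessAt G (Kerr.radius a) x‖
        ≤ c * (‖fderiv ℝ (fderiv ℝ (Kerr.radius a)) x‖
          + ‖fderiv ℝ (Kerr.radius a) x‖ * (2⁻¹ * (‖sharpAt G x‖ * (3 * ‖fderiv ℝ G x‖)))) :=
          mul_le_mul_of_nonneg_left hHess hc.le
      _ = c * ‖fderiv ℝ (fderiv ℝ (Kerr.radius a)) x‖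
          + 3 / 2 * (‖fderiv ℝ (Kerr.radius a) x‖ * (‖sharpAt G x‖ * (c * ‖fderiv ℝ G x‖))) := by
          ring
      _ ≤ CK + 3 / 2 * (CK * (2 * 1)) := by gcongr
      _ = C := by rw [hC_eq]; ring
  -- (3) F2a with `S = G x`, `H = c • Hess r`, `v = ∂₀`, `D = Dr(x)`
  have key := stub_multiplierOfTimelike C hC (G x) (c • hessAt G (Kerr.radius a) x)
    (E4.basisVector 0) (fderiv ℝ (Kerr.radius a) x) (hG.symm x hx) hGη
    (by rw [sub_self, norm_zero]; positivity) hHn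
  refine ⟨C + 2, ?_, fun w ↦ ?_⟩
  · rw [abs_of_pos hK, one_div, inv_inv]
    linarith
  · have hw := key w
    rw [farMult_smul_apply₂] at hw
    exact hw

end Summit.FinalStateConjecture.FinalStateConjecture.Theorems

end
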